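import Summits.Langlands.Langlands.Theses.DyadicOddResidue
import Summits.Langlands.Langlands.Theorems.DyadicDihedralFM.Negative.IrreducibleRedundant

/-!
# `DyadicDihedralFM` (crux stmt-Langlands-18742, route `DyadicOddResidue`): the hypothesis
# `IsSolvable ρ.residualRep.range` is CHOICE-FREE and `ρ.residualRep` is NOT junk under `hres` —
# the crux is equivalent to its form over an EXPLICIT absolutely irreducible reduction
# (negative-side support, refuter cdisprove seat; well-posedness of a load-bearing hypothesis,
# sorry-free)

`DyadicDihedralFM` carries `hsol : IsSolvable ρ.residualRep.range`, where
`FramedGaloisRep.residualRep ρ` is a `Classical.choose`-n semisimplified reduction of `ρ` over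
`ℤ̄₂/𝔪` with JUNK VALUE `1` when no semisimplified reduction exists (and the existence proof its
docstring cites, `ResidualGaloisRepProofs`, is not in the tree). An adversarial reading of the crux
therefore asks: (i) can `residualRep` be the junk `1` (then `hsol` is vacuously true and the cell is
mis-cut)? (ii) does `hsol` depend on the hidden choice? We certify NO to both, kernel-checked:

* `residualRep_isResidualRepOf` — under `hres : ρ.IsResiduallyAbsIrreducible` the chosen
  `ρ.residualRep` IS a residual representation of `ρ` (the absolutely irreducible reduction given by
  `hres` is irreducible over `ℤ̄_ℓ/𝔪` itself, `isIrreducible_of_isAbsIrreducible`, hence a residual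
  representation, `IsReductionOf.isResidualRepOf_of_isIrreducible`, so `residualRep_spec` fires).
* `isSolvable_range_iff_of_isResidualRepOf` — any two residual representations `τ, σ` of `ρ` along
  the same residue embedding have simultaneously solvable ranges: they have the same characteristic
  polynomials (`charpoly_eq_of_isResidualRepOf`: both are reductions of the unique integral lift of
  `charpoly ρ(g)`), are semisimple, hence EQUIVALENT by the tree's Brauer–Nesbitt theorem
  (`brauerNesbitt_holds`; `nonempty_equiv_of_isResidualRepOf`), hence CONJUGATE in `GL_n`
  (`exists_conj_of_equiv`), and conjugate homomorphisms have isomorphic ranges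
  (`isSolvable_range_of_conj`).
* `isSolvable_residualRep_range_iff` — so for every absolutely irreducible reduction `τ` of `ρ`,
  `IsSolvable ρ.residualRep.range ↔ IsSolvable τ.range`; and
* `dyadicDihedralFM_iff_explicitReduction` — the crux is EQUIVALENT to the choice-free statement
  quantifying over an explicit reduction `τ` with `ρ.IsReductionOf (RingHom.id _) τ`,
  `IsAbsIrreducible τ`, `IsSolvable τ.range` in place of `hres`, `hsol` (and without the redundant
  `hirr`, cf. `IrreducibleRedundant.lean`) — stated inline, no proposition defined under `Summits/`.

Moral for provers: you may replace `(hres, hsol)` by YOUR dihedral reduction `τ` and never touch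
`Classical.choose`; for refuters: the `residualRep` junk value is unreachable inside this crux, so no
mis-cut of the dihedral cell can be exploited. This file does NOT refute the crux.
(Refs: Darmon–Diamond–Taylor 1995 §2.1, Prop. 2.6 (b); Bourbaki, Algèbre VIII §20 n°6 Cor. 1.)
-/

noncomputable section

set_option linter.dupNamespace false

namespace Summit.Langlands.Langlands.Theorems.DyadicDihedralFM.Negative

open scoped MatrixGroups
open Literature.NumberTheory.GaloisRepresentations IsLocalRing

/-- An absolutely irreducible `τ : G → GL_n(k)` is irreducible over `k` itself (`f = id`).
[folklore] -/
theorem isIrreducible_of_isAbsIrreducible {G : Type*} [Group G] {k : Type*} [Field k] {n : ℕ}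
    {τ : G →* GL (Fin n) k} (h : IsAbsIrreducible τ) : (glRepresentation τ).IsIrreducible := by
  have h1 := h k (RingHom.id k)
  have e : (Matrix.GeneralLinearGroup.map (n := Fin n) (RingHom.id k)).comp τ = τ := by
    refine MonoidHom.ext fun g => Units.ext ?_
    ext i j
    simp
  rwa [e] at h1

variable {ℓ : ℕ} [Fact ℓ.Prime] {K : Type*} [Field K] {n : ℕ}

/-- **No junk under `hres`.** If `ρ` is residually absolutely irreducible, the chosen
`ρ.residualRep` is a genuine residual representation of `ρ` (the `dif_pos` branch of its
definition). [folklore] -/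
theorem residualRep_isResidualRepOf (ρ : FramedGaloisRep K (PadicAlgCl ℓ) n)
    (hres : ρ.IsResiduallyAbsIrreducible) : ρ.IsResidualRepOf (RingHom.id _) ρ.residualRep := by
  obtain ⟨τ, hτ, habs⟩ := hres
  exact FramedGaloisRep.residualRep_spec ρ
    ⟨τ, hτ.isResidualRepOf_of_isIrreducible (isIrreducible_of_isAbsIrreducible habs)⟩

/-- Two residual representations of `ρ` along the same residue embedding have the same
characteristic polynomials (both reduce the unique lift of `charpoly ρ(g)` to `ℤ̄_ℓ[X]`).
[folklore] -/
theorem charpoly_eq_of_isResidualRepOf (ρ : FramedGaloisRep K (PadicAlgCl ℓ) n) {k : Type*}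
    [Field k] {ι : padicAlgClResidueField ℓ →+* k}
    {τ σ : Field.absoluteGaloisGroup K →* GL (Fin n) k}
    (hτ : ρ.IsResidualRepOf ι τ) (hσ : ρ.IsResidualRepOf ι σ) (g : Field.absoluteGaloisGroup K) :
    ((τ g : GL (Fin n) k) : Matrix (Fin n) (Fin n) k).charpoly =
      ((σ g : GL (Fin n) k) : Matrix (Fin n) (Fin n) k).charpoly := by
  obtain ⟨P, hP, hPτ⟩ := hτ.hasResidualCharpolys g
  obtain ⟨Q, hQ, hQσ⟩ := hσ.hasResidualCharpolys g
  have hPQ : P = Q :=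
    Polynomial.map_injective (padicAlgClIntegers ℓ).subtype Subtype.val_injective (hP.trans hQ.symm)
  rw [← hPτ, ← hQσ, hPQ]

/-- **Brauer–Nesbitt for residual representations**: any two residual representations of `ρ`
(same residue embedding) are equivalent as representations on `kⁿ` (tree fact
`brauerNesbitt_holds`). (Darmon–Diamond–Taylor 1995, Prop. 2.6 (b).) -/
theorem nonempty_equiv_of_isResidualRepOf (ρ : FramedGaloisRep K (PadicAlgCl ℓ) n) {k : Type*}
    [Field k] {ι : padicAlgClResidueField ℓ →+* k}
    {τ σ : Field.absoluteGaloisGroup K →* GL (Fin n) k}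
    (hτ : ρ.IsResidualRepOf ι τ) (hσ : ρ.IsResidualRepOf ι σ) :
    Nonempty ((glRepresentation τ).Equiv (glRepresentation σ)) := by
  refine brauerNesbitt_holds (glRepresentation τ) (glRepresentation σ)
    hτ.isSemisimpleRepresentation hσ.isSemisimpleRepresentation fun g => ?_
  have eτ : (glRepresentation τ g : (Fin n → k) →ₗ[k] (Fin n → k)) =
      Matrix.toLin' ((τ g : GL (Fin n) k) : Matrix (Fin n) (Fin n) k) :=
    LinearMap.ext fun v => by rw [Matrix.toLin'_apply]; rfl
  have eσ : (glRepresentation σ g : (Fin n → k) →ₗ[k] (Fin n → k)) =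
      Matrix.toLin' ((σ g : GL (Fin n) k) : Matrix (Fin n) (Fin n) k) :=
    LinearMap.ext fun v => by rw [Matrix.toLin'_apply]; rfl
  rw [eτ, eσ, Matrix.charpoly_toLin', Matrix.charpoly_toLin']
  exact charpoly_eq_of_isResidualRepOf ρ hτ hσ g

/-- An equivalence of the representations on `kⁿ` attached to `τ, σ : G → GL_n(k)` is a
conjugation in `GL_n(k)`: `σ(g) = P τ(g) P⁻¹` with `P` the matrix of the equivalence. [folklore] -/
theorem exists_conj_of_equiv {G : Type*} [Group G] {k : Type*} [Field k] {n : ℕ}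
    {τ σ : G →* GL (Fin n) k} (e : (glRepresentation τ).Equiv (glRepresentation σ)) :
    ∃ P : GL (Fin n) k, ∀ g, σ g = P * τ g * P⁻¹ := by
  set eL : (Fin n → k) ≃ₗ[k] (Fin n → k) := e.toLinearEquiv with heL
  have hinter : ∀ g v, eL (glRepresentation τ g v) = glRepresentation σ g (eL v) := fun g v =>
    LinearMap.congr_fun (e.isIntertwining' g) v
  set Pm : Matrix (Fin n) (Fin n) k := LinearMap.toMatrix' eL.toLinearMap with hPm
  set Qm : Matrix (Fin n) (Fin n) k := LinearMap.toMatrix' eL.symm.toLinearMap with hQm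
  have hPQ : Pm * Qm = 1 := by
    rw [hPm, hQm, ← LinearMap.toMatrix'_comp, LinearEquiv.comp_coe, LinearEquiv.symm_trans_self,
      LinearEquiv.refl_toLinearMap, LinearMap.toMatrix'_id]
  have hQP : Qm * Pm = 1 := by
    rw [hPm, hQm, ← LinearMap.toMatrix'_comp, LinearEquiv.comp_coe, LinearEquiv.self_trans_symm,
      LinearEquiv.refl_toLinearMap, LinearMap.toMatrix'_id]
  let P : GL (Fin n) k := ⟨Pm, Qm, hPQ, hQP⟩
  have hPv : ∀ v, Pm.mulVec v = eL v := fun v => by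
    rw [hPm, ← Matrix.toLin'_apply, Matrix.toLin'_toMatrix']
    rfl
  refine ⟨P, fun g => ?_⟩
  have hmat : ((σ g : GL (Fin n) k) : Matrix (Fin n) (Fin n) k) * Pm =
      Pm * ((τ g : GL (Fin n) k) : Matrix (Fin n) (Fin n) k) := by
    refine Matrix.toLin'.injective (LinearMap.ext fun v => ?_)
    rw [Matrix.toLin'_apply, Matrix.toLin'_apply, ← Matrix.mulVec_mulVec, ← Matrix.mulVec_mulVec,
      hPv, hPv]
    exact (hinter g v).symm
  refine Units.ext ?_
  rw [Units.val_mul, Units.val_mul]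
  change ((σ g : GL (Fin n) k) : Matrix (Fin n) (Fin n) k) =
    Pm * ((τ g : GL (Fin n) k) : Matrix (Fin n) (Fin n) k) * ((P⁻¹ : GL (Fin n) k) : Matrix _ _ k)
  have hPinv : ((P⁻¹ : GL (Fin n) k) : Matrix (Fin n) (Fin n) k) = Qm := rfl
  rw [hPinv, ← hmat, mul_assoc, hPQ, mul_one]

/-- Conjugate homomorphisms have simultaneously solvable ranges (the range of `P τ P⁻¹` is the
image of the range of `τ` under `MulAut.conj P`). [folklore] -/
theorem isSolvable_range_of_conj {G H : Type*} [Group G] [Group H] {τ σ : G →* H} (P : H)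
    (h : ∀ g, σ g = P * τ g * P⁻¹) (hτ : IsSolvable τ.range) : IsSolvable σ.range := by
  have hσ : σ = (MulAut.conj P).toMonoidHom.comp τ := MonoidHom.ext fun g => by simp [h g]
  have hrange : σ.range = τ.range.map (MulAut.conj P).toMonoidHom := by
    rw [hσ, MonoidHom.range_comp]
  rw [hrange]
  exact solvable_of_surjective (MonoidHom.subgroupMap_surjective _ _)

/-- **Choice-freeness of `hsol`.** Any two residual representations of `ρ` along the same residue
embedding have simultaneously solvable ranges. -/
theorem isSolvable_range_iff_of_isResidualRepOf (ρ : FramedGaloisRep K (PadicAlgCl ℓ) n)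
    {k : Type*} [Field k] {ι : padicAlgClResidueField ℓ →+* k}
    {τ σ : Field.absoluteGaloisGroup K →* GL (Fin n) k}
    (hτ : ρ.IsResidualRepOf ι τ) (hσ : ρ.IsResidualRepOf ι σ) :
    IsSolvable τ.range ↔ IsSolvable σ.range := by
  constructor
  · intro h
    obtain ⟨e⟩ := nonempty_equiv_of_isResidualRepOf ρ hτ hσ
    obtain ⟨P, hP⟩ := exists_conj_of_equiv e
    exact isSolvable_range_of_conj P hP h
  · intro h
    obtain ⟨e⟩ := nonempty_equiv_of_isResidualRepOf ρ hσ hτ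
    obtain ⟨P, hP⟩ := exists_conj_of_equiv e
    exact isSolvable_range_of_conj P hP h

/-- **`hsol` on the chosen `residualRep` ↔ `hsol` on ANY absolutely irreducible reduction `τ`.** -/
theorem isSolvable_residualRep_range_iff (ρ : FramedGaloisRep K (PadicAlgCl ℓ) n)
    {τ : Field.absoluteGaloisGroup K →* GL (Fin n) (padicAlgClResidueField ℓ)}
    (hτ : ρ.IsReductionOf (RingHom.id _) τ) (habs : IsAbsIrreducible τ) :
    IsSolvable ρ.residualRep.range ↔ IsSolvable τ.range :=
  isSolvable_range_iff_of_isResidualRepOf ρ (residualRep_isResidualRepOf ρ ⟨τ, hτ, habs⟩)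
    (hτ.isResidualRepOf_of_isIrreducible (isIrreducible_of_isAbsIrreducible habs))

/-- **The crux, choice-free.** `DyadicDihedralFM` is equivalent to the statement over an EXPLICIT
absolutely irreducible reduction `τ` of `ρ` with solvable image, replacing `hres`, `hsol` AND the
redundant `hirr` (recovered by `isIrreducible_of_isResiduallyAbsIrreducible` of
`IrreducibleRedundant.lean` from `hres := ⟨τ, hτ, habs⟩`). Everything else verbatim. -/
theorem dyadicDihedralFM_iff_explicitReduction :
    Summit.Langlands.Langlands.Theses.DyadicOddResidue.DyadicDihedralFM ↔
    (∀ (ℓ : ℕ) [Fact ℓ.Prime], ℓ = 2 →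
      ∀ (ρ : Literature.NumberTheory.GaloisRepresentations.FramedGaloisRep ℚ (PadicAlgCl ℓ) 2)
        (τ : Field.absoluteGaloisGroup ℚ →* GL (Fin 2) (padicAlgClResidueField ℓ)),
      ρ.IsReductionOf (RingHom.id _) τ → IsAbsIrreducible τ → IsSolvable τ.range → ρ.IsOdd →
      (∀ᶠ v : IsDedekindDomain.HeightOneSpectrum (NumberField.RingOfIntegers ℚ) in Filter.cofinite,
        ρ.IsUnramifiedAt v) →
      (∀ (v : IsDedekindDomain.HeightOneSpectrum (NumberField.RingOfIntegers ℚ))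
        (hv : ((ℓ : ℕ) : NumberField.RingOfIntegers ℚ) ∈ v.asIdeal),
        (Literature.NumberTheory.PAdicHodge.fontainePstAdicCompletion v ℓ hv).IsDeRhamFramed
          (ρ.toLocal v) ∧
        ∀ τ : v.adicCompletion ℚ →+* PadicAlgCl ℓ, Continuous τ →
          (ρ.labelledHodgeTateWeightsAt v
            (Literature.NumberTheory.PAdicHodge.fontainePstAdicCompletion v ℓ hv).algebra
            (Literature.NumberTheory.PAdicHodge.fontainePstAdicCompletion v ℓ hv).𝔅 τ).Nodup) →
      ∀ (hcpt : Literature.NumberTheory.Automorphic.isCompact_glFiniteIntegralLevel 2 ℚ)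
        (ι : PadicAlgCl ℓ ≃+* ℂ),
        ∃ π : Literature.NumberTheory.Automorphic.CuspidalAutomorphicRepData 2 ℚ hcpt,
          π.1.IsLAlgebraic ∧
          ∀ᶠ v : IsDedekindDomain.HeightOneSpectrum (NumberField.RingOfIntegers ℚ) in Filter.cofinite,
            Summit.Langlands.SatakeFrobCompatibleAt ι π.1 ρ v) := by
  constructor
  · intro h ℓ _ hℓ ρ τ hτ habs hsolτ hodd hunr hdR hcpt ι
    have hres : ρ.IsResiduallyAbsIrreducible := ⟨τ, hτ, habs⟩
    exact h ℓ hℓ ρ hres ((isSolvable_residualRep_range_iff ρ hτ habs).2 hsolτ)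
      (isIrreducible_of_isResiduallyAbsIrreducible two_pos ρ hres) hodd hunr hdR hcpt ι
  · intro h ℓ _ hℓ ρ hres hsol _ hodd hunr hdR hcpt ι
    obtain ⟨τ, hτ, habs⟩ := hres
    exact h ℓ hℓ ρ τ hτ habs ((isSolvable_residualRep_range_iff ρ hτ habs).1 hsol) hodd hunr hdR
      hcpt ι

end Summit.Langlands.Langlands.Theorems.DyadicDihedralFM.Negative

end
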